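import Summits.MatrixMultiplication.MatrixMultiplication.Theorems.ThinPackings.Negative.ThinPackingsPacking

/-!
# Packing necessities for the witnesses of `ThinBlockAlpha.ThinPackings` (crux stmt-MatrixMultiplication-10595), II: refuted strengthenings

Negative-side lemmas of the standing disprover (cdisprove), sorry-free.  Four natural
strengthenings of the crux `ThinPackings` are FALSE:

* S1 exact two-leg packing `η = 0` — for every `a > 0` (`no_exact_thin_packing`);
* S2 a single block `L = 1` — whenever `η < a` (`no_single_thin_block`);
* S3 bounded long legs `N ≤ N₀` (`not_thinPackingsBoundedN`, via `M ≤ N(N^η − 1) + 1`);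
* S4 bounded exponent (`not_thinPackingsBoundedExponent`, via the tree's BCCGNSU Thm B);

and the `a = 0` slice is TRUE even with exact packing (`thinPackingsAtZero_exact`), so exact
packing happens iff `a = 0`.  Consequently every witness family for the crux has `a > 0 ⇒ M ≥ 2`,
`L ≥ N^{a−η} → ∞`, `N → ∞` as `η → 0`, and exponent `→ ∞` as `a → 1` — the regime with no
catalogued barrier and no known design.  None of this refutes the crux.

References: Blasiak–Church–Cohn–Grochow–Naslund–Sawin–Umans, Discrete Analysis 2017:3
(arXiv:1605.06702) Thm. B; Cohn–Umans FOCS 2003 Lemma 3.1.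
-/

namespace Summit.MatrixMultiplication.MatrixMultiplication.Theorems.ThinPackings.Negative

open Literature.Computability.AlgebraicComplexity Finset

/-! ## Refuted strengthenings -/

section Strengthenings

/-- For every `a > 0` there is NO exactly packed thin family: `M ≥ 2` and then `L·N² < |H|`
(`thin_packing_strict`).  So the slack `η > 0` in the crux is load-bearing, and `η = 0` is
attained only at `a = 0` (see `thinPackingsAtZero_exact` below). [new, elementary] -/
theorem no_exact_thin_packing {a : ℝ} (ha : 0 < a) :
    ¬ ∃ (H : Type) (_ : AddCommGroup H) (_ : Fintype H) (L N M : ℕ) (A B C : Fin L → Finset H),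
      IsSTPP A B C ∧ (∀ i, (A i).card = N ∧ (B i).card = M ∧ (C i).card = N) ∧ 2 ≤ N ∧
      (N : ℝ) ^ a ≤ M ∧ (Fintype.card H : ℝ) ≤ L * (N : ℝ) ^ 2 := by
  rintro ⟨H, _, _, L, N, M, A, B, C, hS, hc, hN, hM, hH⟩
  have hM2 := two_le_M hN ha hM
  have hL : 1 ≤ L := by
    by_contra h0
    have hL0 : L = 0 := by omega
    rw [hL0, Nat.cast_zero, zero_mul] at hH
    have : (0 : ℝ) < Fintype.card H := by exact_mod_cast Fintype.card_pos
    linarith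
  have hlt := thin_packing_strict hS hc (by omega) hM2 hL
  have hlt' : ((L * (N * N) : ℕ) : ℝ) < Fintype.card H := by exact_mod_cast hlt
  push_cast at hlt'
  nlinarith [hH, hlt']

/-- Strengthening S1 — EXACT two-leg packing (`η = 0`, i.e. `|H| ≤ L·N²`) for all `a < 1` — is
false (already at `a = 1/2`). [new, elementary] -/
theorem not_thinPackingsExact :
    ¬ ∀ a : ℝ, 0 ≤ a → a < 1 → ∃ (H : Type) (_ : AddCommGroup H) (_ : Fintype H) (L N M : ℕ)
      (A B C : Fin L → Finset H), IsSTPP A B C ∧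
      (∀ i, (A i).card = N ∧ (B i).card = M ∧ (C i).card = N) ∧ 2 ≤ N ∧ (N : ℝ) ^ a ≤ M ∧
      (Fintype.card H : ℝ) ≤ L * (N : ℝ) ^ 2 := fun h =>
  no_exact_thin_packing one_half_pos (h (1 / 2) (by norm_num) (by norm_num))

/-- A single thin triple in an abelian group needs `a ≤ η` (Cohn–Umans: `N²M ≤ |H|`), so S2 fails
at every `(a, η)` with `η < a`. [new, elementary; cf. CohnUmans2003 Lemma 3.1] -/
theorem no_single_thin_block {a η : ℝ} (hηa : η < a) :
    ¬ ∃ (H : Type) (_ : AddCommGroup H) (_ : Fintype H) (N M : ℕ) (A B C : Fin 1 → Finset H),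
      IsSTPP A B C ∧ (∀ i, (A i).card = N ∧ (B i).card = M ∧ (C i).card = N) ∧ 2 ≤ N ∧
      (N : ℝ) ^ a ≤ M ∧ (Fintype.card H : ℝ) ≤ (N : ℝ) ^ (2 + η) := by
  rintro ⟨H, _, _, N, M, A, B, C, hS, hc, hN, hM, hH⟩
  have hH' : (Fintype.card H : ℝ) ≤ ((1 : ℕ) : ℝ) * (N : ℝ) ^ (2 + η) := by simpa using hH
  have h := rpow_sub_le_L hS hc hN hM hH'
  have h1 : (1 : ℝ) < (N : ℝ) ^ (a - η) :=
    Real.one_lt_rpow (by exact_mod_cast (by omega : 1 < N)) (by linarith)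
  simp at h
  linarith

/-- Strengthening S2 — a SINGLE thin TPP triple (`L = 1`) for all `a < 1`, `η > 0` — is false
(already at `a = 1/2`, `η = 1/4`). [new, elementary] -/
theorem not_thinPackingsSingleBlock :
    ¬ ∀ a : ℝ, 0 ≤ a → a < 1 → ∀ η : ℝ, 0 < η → ∃ (H : Type) (_ : AddCommGroup H) (_ : Fintype H)
      (N M : ℕ) (A B C : Fin 1 → Finset H), IsSTPP A B C ∧
      (∀ i, (A i).card = N ∧ (B i).card = M ∧ (C i).card = N) ∧ 2 ≤ N ∧ (N : ℝ) ^ a ≤ M ∧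
      (Fintype.card H : ℝ) ≤ (N : ℝ) ^ (2 + η) := fun h =>
  no_single_thin_block (by norm_num : (1 / 4 : ℝ) < 1 / 2)
    (h (1 / 2) (by norm_num) (by norm_num) (1 / 4) (by norm_num))

/-- Strengthening S3 — witnesses with BOUNDED long legs `N ≤ N₀` (only `L`, `H` grow) — is
false: by `M_le` and Bernoulli, `M ≤ η·N·(N−1) + 1 < 2` once `η < 1/N₀²`, whereas
`a > 0` forces `M ≥ 2`.  Hence in any witness sequence for the crux `N → ∞` as `η → 0`
(quantitatively `N^η ≥ 1 + (M−1)/N`). [new, elementary] -/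
theorem not_thinPackingsBoundedN :
    ¬ ∃ N₀ : ℕ, ∀ a : ℝ, 0 ≤ a → a < 1 → ∀ η : ℝ, 0 < η → ∃ (H : Type) (_ : AddCommGroup H)
      (_ : Fintype H) (L N M : ℕ) (A B C : Fin L → Finset H), IsSTPP A B C ∧
      (∀ i, (A i).card = N ∧ (B i).card = M ∧ (C i).card = N) ∧ 2 ≤ N ∧ N ≤ N₀ ∧
      (N : ℝ) ^ a ≤ M ∧ (Fintype.card H : ℝ) ≤ L * (N : ℝ) ^ (2 + η) := by
  rintro ⟨N₀, h⟩
  set η : ℝ := 1 / (2 * (N₀ : ℝ) ^ 2 + 2) with hη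
  have hden : (0 : ℝ) < 2 * (N₀ : ℝ) ^ 2 + 2 := by positivity
  have hη0 : 0 < η := by rw [hη]; positivity
  have hη1 : η ≤ 1 := by
    rw [hη, div_le_one hden]; nlinarith [sq_nonneg (N₀ : ℝ)]
  obtain ⟨H, _, _, L, N, M, A, B, C, hS, hc, hN, hNN₀, hM, hH⟩ :=
    h (1 / 2) (by norm_num) (by norm_num) η hη0
  have hM2 := two_le_M hN one_half_pos hM
  have hMle := M_le hS hc hN (by norm_num) hM hH
  have hN1 : (1 : ℝ) ≤ N := by exact_mod_cast (by omega : 1 ≤ N)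
  have hNN₀' : (N : ℝ) ≤ N₀ := by exact_mod_cast hNN₀
  -- Bernoulli: N^η = (1 + (N-1))^η ≤ 1 + η (N - 1)
  have hB : (N : ℝ) ^ η ≤ 1 + η * (N - 1) := by
    have := rpow_one_add_le_one_add_mul_self (s := (N : ℝ) - 1) (by linarith) hη0.le hη1
    simpa using this
  have h1 : (M : ℝ) ≤ η * (N₀ : ℝ) ^ 2 + 1 := by
    calc (M : ℝ) ≤ N * ((N : ℝ) ^ η - 1) + 1 := hMle
      _ ≤ N * (η * (N - 1)) + 1 := by gcongr; linarith
      _ = η * (N * (N - 1)) + 1 := by ring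
      _ ≤ η * (N₀ : ℝ) ^ 2 + 1 := by
          have hNN : (N : ℝ) * (N - 1) ≤ (N₀ : ℝ) ^ 2 := by
            rw [sq]; exact mul_le_mul hNN₀' (by linarith) (by linarith) (by positivity)
          linarith [mul_le_mul_of_nonneg_left hNN hη0.le]
  have h2 : η * (N₀ : ℝ) ^ 2 < 1 := by
    rw [hη, div_mul_eq_mul_div, one_mul, div_lt_one hden]; nlinarith [sq_nonneg (N₀ : ℝ)]
  have hM2' : (2 : ℝ) ≤ M := by exact_mod_cast hM2
  linarith

/-- Strengthening S4 — witnesses in abelian groups of BOUNDED EXPONENT (the route's own rungs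
3–5 produce only such witnesses, for each fixed `a`) — is false: BCCGNSU Thm B (tree theorem `…2017_B_holds`, some `ε_ℓ > 0`) gives
`L·(N²M)^{(2+ε)/3} ≤ |H| ≤ L·N^{2+η}`, impossible at `a = 1 − ε'/4`, `η = ε'/8`
(`ε' = min ε 1`).  So for `a` close to `1` the crux needs exponent `→ ∞` — the regime with no
catalogued barrier and no known tight design.
[cite: BlasiakChurchCohnGrochowNaslundSawinUmans2017, Thm. B] -/
theorem not_thinPackingsBoundedExponent :
    ¬ ∃ ℓ : ℕ, ∀ a : ℝ, 0 ≤ a → a < 1 → ∀ η : ℝ, 0 < η → ∃ (H : Type) (_ : AddCommGroup H)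
      (_ : Fintype H) (L N M : ℕ) (A B C : Fin L → Finset H), AddMonoid.exponent H ≤ ℓ ∧
      IsSTPP A B C ∧ (∀ i, (A i).card = N ∧ (B i).card = M ∧ (C i).card = N) ∧ 2 ≤ N ∧
      (N : ℝ) ^ a ≤ M ∧ (Fintype.card H : ℝ) ≤ L * (N : ℝ) ^ (2 + η) := by
  rintro ⟨ℓ, h⟩
  obtain ⟨ε, hε, hB⟩ := BlasiakChurchCohnGrochowNaslundSawinUmans2017_B_holds ℓ
  set ε' : ℝ := min ε 1 with hε'
  have hε'0 : 0 < ε' := lt_min hε one_pos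
  have hε'1 : ε' ≤ 1 := min_le_right _ _
  have hε'ε : ε' ≤ ε := min_le_left _ _
  obtain ⟨H, _, _, L, N, M, A, B, C, hexp, hS, hc, hN, hM, hH⟩ :=
    h (1 - ε' / 4) (by linarith) (by linarith) (ε' / 8) (by positivity)
  have hL := one_le_L hH
  have hLpos : (0 : ℝ) < L := by exact_mod_cast (by omega : 0 < L)
  have hN1 : (1 : ℝ) < N := by exact_mod_cast (by omega : 1 < N)
  have hNpos : (0 : ℝ) < N := by linarith
  -- Thm B on the witness
  have hTB := hB H hexp L A B C hS
  have hsum : ∑ i : Fin L, (((A i).card * (B i).card * (C i).card : ℕ) : ℝ) ^ ((2 + ε) / 3) =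
      L * (((N * M * N : ℕ) : ℝ) ^ ((2 + ε) / 3)) := by
    rw [Finset.sum_congr rfl fun i _ => by rw [(hc i).1, (hc i).2.1, (hc i).2.2], sum_const,
      card_univ, Fintype.card_fin, nsmul_eq_mul]
  rw [hsum] at hTB
  -- volume ≥ N^{2+a}
  have hvol : (N : ℝ) ^ (2 + (1 - ε' / 4)) ≤ ((N * M * N : ℕ) : ℝ) := by
    rw [Real.rpow_add hNpos, Real.rpow_two]
    push_cast
    calc (N : ℝ) ^ 2 * (N : ℝ) ^ (1 - ε' / 4) ≤ (N : ℝ) ^ 2 * (M : ℝ) := by gcongr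
      _ = (N : ℝ) * M * N := by ring
  have hexp_pos : (0 : ℝ) < (2 + ε) / 3 := by positivity
  have h1 : (N : ℝ) ^ ((2 + (1 - ε' / 4)) * ((2 + ε) / 3)) ≤ (N : ℝ) ^ (2 + ε' / 8) := by
    calc (N : ℝ) ^ ((2 + (1 - ε' / 4)) * ((2 + ε) / 3))
        = ((N : ℝ) ^ (2 + (1 - ε' / 4))) ^ ((2 + ε) / 3) := Real.rpow_mul hNpos.le _ _
      _ ≤ (((N * M * N : ℕ) : ℝ)) ^ ((2 + ε) / 3) :=
          Real.rpow_le_rpow (by positivity) hvol hexp_pos.le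
      _ ≤ (N : ℝ) ^ (2 + ε' / 8) := by
          have h2 : (L : ℝ) * ((N * M * N : ℕ) : ℝ) ^ ((2 + ε) / 3) ≤ L * (N : ℝ) ^ (2 + ε' / 8) :=
            hTB.trans hH
          exact le_of_mul_le_mul_left h2 hLpos
  have h3 : (2 + (1 - ε' / 4)) * ((2 + ε) / 3) ≤ 2 + ε' / 8 := (Real.rpow_le_rpow_left_iff hN1).1 h1
  nlinarith [mul_nonneg hε'0.le hε'0.le, hε'ε, hε'1]

end Strengthenings

/-! ## The `a = 0` slice is exactly packable -/

section AtZero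

/-- W3 — the `a = 0` slice holds, even with EXACT packing (`η = 0`): one block `⟨2, 1, 2⟩` in
`(ℤ/2)²`, `A = ℤ/2 × 0`, `B = {0}`, `C = 0 × ℤ/2`, `|H| = 4 = 1·2²` (a coset tiling; the planner's
"KSS-tight coset designs", which certify only the trivial `ω(1,a,1) ≤ 2 + a`).  Together with
`no_exact_thin_packing`: exact two-leg packing happens iff `a = 0`. [small model] -/
theorem thinPackingsAtZero_exact :
    ∃ (H : Type) (_ : AddCommGroup H) (_ : Fintype H) (L N M : ℕ) (A B C : Fin L → Finset H),
      IsSTPP A B C ∧ (∀ i, (A i).card = N ∧ (B i).card = M ∧ (C i).card = N) ∧ 2 ≤ N ∧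
      (N : ℝ) ^ (0 : ℝ) ≤ M ∧ (Fintype.card H : ℝ) ≤ L * (N : ℝ) ^ 2 := by
  refine ⟨ZMod 2 × ZMod 2, inferInstance, inferInstance, 1, 2, 1, fun _ => {(0, 0), (1, 0)},
    fun _ => {(0, 0)}, fun _ => {(0, 0), (0, 1)}, ?_, fun i => ?_, le_rfl, ?_, ?_⟩
  · unfold IsSTPP
    set_option synthInstance.maxSize 1024 in
    set_option synthInstance.maxHeartbeats 200000 in
    decide
  · dsimp only
    decide
  · simp
  · norm_num [Fintype.card_prod, ZMod.card]

/-- The `a = 0` slice of the crux itself (all `η > 0`). [small model] -/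
theorem thinPackings_at_zero (η : ℝ) (hη : 0 < η) :
    ∃ (H : Type) (_ : AddCommGroup H) (_ : Fintype H) (L N M : ℕ) (A B C : Fin L → Finset H),
      IsSTPP A B C ∧ (∀ i, (A i).card = N ∧ (B i).card = M ∧ (C i).card = N) ∧ 2 ≤ N ∧
      (N : ℝ) ^ (0 : ℝ) ≤ M ∧ (Fintype.card H : ℝ) ≤ L * (N : ℝ) ^ (2 + η) := by
  obtain ⟨H, i1, i2, L, N, M, A, B, C, hS, hc, hN, hM, hH⟩ := thinPackingsAtZero_exact
  refine ⟨H, i1, i2, L, N, M, A, B, C, hS, hc, hN, hM, hH.trans ?_⟩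
  have hN1 : (1 : ℝ) ≤ N := by exact_mod_cast (by omega : 1 ≤ N)
  have h2 : (N : ℝ) ^ 2 ≤ (N : ℝ) ^ (2 + η) := by
    rw [← Real.rpow_two]
    exact Real.rpow_le_rpow_of_exponent_le hN1 (by linarith)
  exact mul_le_mul_of_nonneg_left h2 (Nat.cast_nonneg L)

end AtZero

end Summit.MatrixMultiplication.MatrixMultiplication.Theorems.ThinPackings.Negative
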